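import Literature.NumberTheory.Automorphic.ArchRootSubgroupJetIntegral        -- ★ C p844459 (this seat): carriers, ★ Z2 under the integral sign, `archLocal` stack
import HarnessLib

/-!
# Angular jets of torus orbital integrals on `U(diag a)_w ≤ GL_N(ℂ)`: `∂_k O = O_k′`, `∂_k O_k′ = O_kk″` at a regular torus point (Varadarajan 1989 §6.3; Folland 1995 §2.6) —
# ★ Z3b `hasDerivAt_orbitalIntegral_torusCurve` for one angle of any `GL_N`

Topic `NumberTheory/Automorphic`; namespace `Literature.NumberTheory.Automorphic.RootVectors`.  THEOREMS ONLY (no `def`, no instance, no notation, no axiom, no named fact, no `sorry`).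
Cell `pub/hodgecm-mathlib`, ENGINE T1 (crux H413 = `stmt-HodgeConjecture-24833`); ROAD A owner word 2026-09-01T12:22:33Z (o2′) «RANK-2 CASIMIR RADIAL EQUATION» (census bac477e2), FILE D3
(identifies the bound functionals `O_k′`, `O_kk″` of ★ D2 `prod_smul_twoCasimir_orbital_eq` with the first and second derivative of `O` along the `k`-th angle).  Author A-p18 (g26), 2026-09-01.

WHAT IS PROVED (any `N`; `a_i ≠ 0`; `μ` finite on compacta on `G_w = U(diag a)_w`; `Θ ∈ C²_c(M_N(ℂ); E)`; `z ∈ (S¹)^N` injective; `k : Fin N`; the ANGLE CURVE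
`M(s) = diag(z₀, …, z_k e^{is}, …, z_{N−1})`, bound with a defining hypothesis, and `O(s) = ∫ Θ(hM(s)h⁻¹) dμ`, `O′(s) = ∫ DΘ(hM(s)h⁻¹)(h·M(s)iE_kk·h⁻¹) dμ`,
`O″(s) = ∫ [D²Θ(hM(s)h⁻¹)(h·M(s)iE_kk·h⁻¹)² + DΘ(hM(s)h⁻¹)(h·M(s)(iE_kk)²·h⁻¹)] dμ`):
* `angleCurve_eq` (`M(s) = diag z + (e^{is} − 1)•(diag z·E_kk)`), `hasDerivAt_angleCurve` (`M′(s) = M(s)·iE_kk`), `angleCurve_mul_I_smul_single` (closed forms of the jets), `angleCurve_zero`;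
* `hasDerivAt_orbital_angle`: the two integrands at `s = 0` are integrable, `HasDerivAt O (O′ 0) 0` and `HasDerivAt O′ (O″ 0) 0` (★ Z2 (a), (b) with ONE compact carrier over a closed
  ball of regular parameters: ★ `isOpen_setOf_injective`, ★ `isCompact_setOf_exists_conj_circleDiagonal_mem`).
HONEST LABEL: one-variable calculus under the integral sign; pays nothing by itself (HC_CM is proved only modulo the printed citations until rung 0 closes).

## References
* [Varadarajan1989] V. S. Varadarajan, *An Introduction to Harmonic Analysis on Semisimple Lie Groups* (1989), §6.3.
* [Folland1995] G. B. Folland, *A Course in Abstract Harmonic Analysis* (1995), §2.6.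
-/

set_option autoImplicit false

namespace Literature.NumberTheory.Automorphic.RootVectors

open _root_.Complex _root_.Matrix _root_.MeasureTheory _root_.Set _root_.Filter _root_.Topology _root_.NumberField _root_.NumberField.InfinitePlace
open _root_.Literature.NumberTheory.Automorphic.UnitaryGroup _root_.Literature.NumberTheory.Automorphic.ConjugationCurve
open scoped Matrix.Norms.Operator MatrixGroups ComplexConjugate

variable {N : ℕ}

/-! ## §1 The angle curve `M(s) = diag(…, z_k e^{is}, …)` and its jets -/

section Curve

variable (z : Fin N → Circle) (k : Fin N)

/-- Closed form: `diag(update z k (z_k e^{is})) = diag z + (e^{is} − 1)•(diag z·E_kk)`. [cite: Varadarajan1989, §6.3] -/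
theorem angleCurve_eq (s : ℝ) :
    Matrix.diagonal (fun i => ((Function.update z k (z k * Circle.exp s) i : Circle) : ℂ)) = Matrix.diagonal (fun i => ((z i : Circle) : ℂ)) + (cexp (s * I) - 1) • (Matrix.diagonal (fun i => ((z i : Circle) : ℂ)) * Matrix.single k k (1 : ℂ)) := by
  ext i j
  rw [diagonal_mul_single]
  simp only [Matrix.add_apply, Matrix.smul_apply, Matrix.diagonal_apply, Matrix.single_apply, Function.update_apply, smul_eq_mul]
  by_cases hki : k = i
  · subst hki
    by_cases hkj : k = j
    · subst hkj
      simp only [if_true, and_self, mul_one, Circle.coe_mul, Circle.coe_exp]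
      ring
    · simp only [hkj, if_false, and_false, mul_zero, add_zero]
  · simp only [Ne.symm hki, hki, if_false, false_and, mul_zero, add_zero]

/-- `M(0) = diag z`. [cite: Varadarajan1989, §6.3] -/
theorem angleCurve_zero : Matrix.diagonal (fun i => ((Function.update z k (z k * Circle.exp 0) i : Circle) : ℂ)) = Matrix.diagonal (fun i => ((z i : Circle) : ℂ)) := by
  rw [Circle.exp_zero, mul_one, Function.update_eq_self]

/-- The jets in closed form: `M(s)·iE_kk = (i e^{is})•(diag z·E_kk)` and `M(s)·iE_kk·iE_kk = (i·i·e^{is})•(diag z·E_kk)`. [cite: Varadarajan1989, §6.3] -/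
theorem angleCurve_mul_I_smul_single (s : ℝ) :
    Matrix.diagonal (fun i => ((Function.update z k (z k * Circle.exp s) i : Circle) : ℂ)) * (I • Matrix.single k k (1 : ℂ)) = (I * cexp (s * I)) • (Matrix.diagonal (fun i => ((z i : Circle) : ℂ)) * Matrix.single k k (1 : ℂ)) ∧
    Matrix.diagonal (fun i => ((Function.update z k (z k * Circle.exp s) i : Circle) : ℂ)) * (I • Matrix.single k k (1 : ℂ)) * (I • Matrix.single k k (1 : ℂ)) = (I * I * cexp (s * I)) • (Matrix.diagonal (fun i => ((z i : Circle) : ℂ)) * Matrix.single k k (1 : ℂ)) := by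
  have h1 : Matrix.diagonal (fun i => ((Function.update z k (z k * Circle.exp s) i : Circle) : ℂ)) * (I • Matrix.single k k (1 : ℂ)) = (I * cexp (s * I)) • (Matrix.diagonal (fun i => ((z i : Circle) : ℂ)) * Matrix.single k k (1 : ℂ)) := by
    rw [angleCurve_eq, Matrix.add_mul, Matrix.smul_mul, Matrix.mul_smul, Matrix.mul_smul, Matrix.mul_assoc (Matrix.diagonal (fun i => ((z i : Circle) : ℂ))) (Matrix.single k k (1 : ℂ)) (Matrix.single k k (1 : ℂ)),
      Matrix.single_mul_single_same, mul_one]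
    module
  refine ⟨h1, ?_⟩
  rw [h1, Matrix.smul_mul, Matrix.mul_smul, Matrix.mul_assoc (Matrix.diagonal (fun i => ((z i : Circle) : ℂ))) (Matrix.single k k (1 : ℂ)) (Matrix.single k k (1 : ℂ)), Matrix.single_mul_single_same, mul_one, smul_smul]
  congr 1
  ring

/-- `M′(s) = M(s)·iE_kk`. [cite: Varadarajan1989, §6.3] -/
theorem hasDerivAt_angleCurve (s : ℝ) :
    HasDerivAt (fun s : ℝ => Matrix.diagonal (fun i => ((Function.update z k (z k * Circle.exp s) i : Circle) : ℂ)))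
      (Matrix.diagonal (fun i => ((Function.update z k (z k * Circle.exp s) i : Circle) : ℂ)) * (I • Matrix.single k k (1 : ℂ))) s := by
  rw [(angleCurve_mul_I_smul_single z k s).1, show (fun s : ℝ => Matrix.diagonal (fun i => ((Function.update z k (z k * Circle.exp s) i : Circle) : ℂ))) =
    fun s : ℝ => Matrix.diagonal (fun i => ((z i : Circle) : ℂ)) + (cexp (s * I) - 1) • (Matrix.diagonal (fun i => ((z i : Circle) : ℂ)) * Matrix.single k k (1 : ℂ)) from funext (angleCurve_eq z k)]
  have h : HasDerivAt (fun x : ℝ => cexp (x * I)) (cexp (s * I) * (1 * I)) s := ((hasDerivAt_id s).ofReal_comp.mul_const I).cexp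
  have h' := ((h.sub_const (1 : ℂ)).smul_const (Matrix.diagonal (fun i => ((z i : Circle) : ℂ)) * Matrix.single k k (1 : ℂ))).const_add (Matrix.diagonal (fun i => ((z i : Circle) : ℂ)))
  rw [show cexp ((s : ℂ) * I) * (1 * I) = I * cexp ((s : ℂ) * I) by ring] at h'
  exact h'

/-- `(M·iE_kk)′(s) = M(s)·iE_kk·iE_kk`. [cite: Varadarajan1989, §6.3] -/
theorem hasDerivAt_angleCurve_deriv (s : ℝ) :
    HasDerivAt (fun s : ℝ => Matrix.diagonal (fun i => ((Function.update z k (z k * Circle.exp s) i : Circle) : ℂ)) * (I • Matrix.single k k (1 : ℂ)))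
      (Matrix.diagonal (fun i => ((Function.update z k (z k * Circle.exp s) i : Circle) : ℂ)) * (I • Matrix.single k k (1 : ℂ)) * (I • Matrix.single k k (1 : ℂ))) s := by
  rw [(angleCurve_mul_I_smul_single z k s).2, show (fun s : ℝ => Matrix.diagonal (fun i => ((Function.update z k (z k * Circle.exp s) i : Circle) : ℂ)) * (I • Matrix.single k k (1 : ℂ))) =
    fun s : ℝ => (I * cexp (s * I)) • (Matrix.diagonal (fun i => ((z i : Circle) : ℂ)) * Matrix.single k k (1 : ℂ)) from funext fun s => (angleCurve_mul_I_smul_single z k s).1]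
  have h : HasDerivAt (fun x : ℝ => cexp (x * I)) (cexp (s * I) * (1 * I)) s := ((hasDerivAt_id s).ofReal_comp.mul_const I).cexp
  have h' := (h.const_mul I).smul_const (Matrix.diagonal (fun i => ((z i : Circle) : ℂ)) * Matrix.single k k (1 : ℂ))
  rw [show I * (cexp ((s : ℂ) * I) * (1 * I)) = I * I * cexp ((s : ℂ) * I) by ring] at h'
  exact h'

end Curve

/-! ## §2 `∂_k O = O_k′`, `∂_k O_k′ = O_kk″` at a regular torus point -/

section Orbital

variable (L : Type) [Field L] (a : Fin N → L) (w : {w : InfinitePlace L // IsComplex w})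
variable {E : Type*} [NormedAddCommGroup E] [NormedSpace ℝ E] [CompleteSpace E]
variable [MeasurableSpace (archLocal L N (Matrix.diagonal a) w)] [BorelSpace (archLocal L N (Matrix.diagonal a) w)]

/-- **Angular jets of the orbital integral at a regular torus point.**  `G_w = U(diag a)_w` (`a_i ≠ 0`), `μ` finite on compacta, `Θ ∈ C²_c(M_N(ℂ); E)`, `z ∈ (S¹)^N` injective,
`k : Fin N`; `M, O, O′, O″` bound with defining hypotheses (angle curve through `z` along `k`; orbital integral and its two angular jet integrals).  Then the jet
integrands at `s = 0` are integrable, `HasDerivAt O (O′ 0) 0` and `HasDerivAt O′ (O″ 0) 0` — ★ Z2 (a), (b) along the angle curve with one compact carrier over a closed ball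
of regular parameters. [cite: Varadarajan1989, §6.3] [cite: Folland1995, §2.6] -/
theorem hasDerivAt_orbital_angle (μ : Measure (archLocal L N (Matrix.diagonal a) w)) [IsFiniteMeasureOnCompacts μ] (ha : ∀ i, a i ≠ 0) (f : Matrix (Fin N) (Fin N) ℂ → E) (hf : ContDiff ℝ 2 f)
    (hfc : HasCompactSupport f) {z : Fin N → Circle} (hz : Function.Injective z) (k : Fin N)
    {M : ℝ → Matrix (Fin N) (Fin N) ℂ} (hM : ∀ s : ℝ, M s = Matrix.diagonal (fun i => ((Function.update z k (z k * Circle.exp s) i : Circle) : ℂ)))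
    {O O' O'' : ℝ → E} (hO : ∀ s : ℝ, O s = ∫ h : archLocal L N (Matrix.diagonal a) w, f (((h : GL (Fin N) ℂ) : Matrix (Fin N) (Fin N) ℂ) * M s * (((h⁻¹ : archLocal L N (Matrix.diagonal a) w) : GL (Fin N) ℂ) : Matrix (Fin N) (Fin N) ℂ)) ∂μ)
    (hO' : ∀ s : ℝ, O' s = ∫ h : archLocal L N (Matrix.diagonal a) w, fderiv ℝ f (((h : GL (Fin N) ℂ) : Matrix (Fin N) (Fin N) ℂ) * M s * (((h⁻¹ : archLocal L N (Matrix.diagonal a) w) : GL (Fin N) ℂ) : Matrix (Fin N) (Fin N) ℂ)) (((h : GL (Fin N) ℂ) : Matrix (Fin N) (Fin N) ℂ) * (M s * (I • Matrix.single k k (1 : ℂ))) * (((h⁻¹ : archLocal L N (Matrix.diagonal a) w) : GL (Fin N) ℂ) : Matrix (Fin N) (Fin N) ℂ)) ∂μ)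
    (hO'' : ∀ s : ℝ, O'' s = ∫ h : archLocal L N (Matrix.diagonal a) w, (fderiv ℝ (fderiv ℝ f) (((h : GL (Fin N) ℂ) : Matrix (Fin N) (Fin N) ℂ) * M s * (((h⁻¹ : archLocal L N (Matrix.diagonal a) w) : GL (Fin N) ℂ) : Matrix (Fin N) (Fin N) ℂ)) (((h : GL (Fin N) ℂ) : Matrix (Fin N) (Fin N) ℂ) * (M s * (I • Matrix.single k k (1 : ℂ))) * (((h⁻¹ : archLocal L N (Matrix.diagonal a) w) : GL (Fin N) ℂ) : Matrix (Fin N) (Fin N) ℂ)) (((h : GL (Fin N) ℂ) : Matrix (Fin N) (Fin N) ℂ) * (M s * (I • Matrix.single k k (1 : ℂ))) * (((h⁻¹ : archLocal L N (Matrix.diagonal a) w) : GL (Fin N) ℂ) : Matrix (Fin N) (Fin N) ℂ)) +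
      fderiv ℝ f (((h : GL (Fin N) ℂ) : Matrix (Fin N) (Fin N) ℂ) * M s * (((h⁻¹ : archLocal L N (Matrix.diagonal a) w) : GL (Fin N) ℂ) : Matrix (Fin N) (Fin N) ℂ)) (((h : GL (Fin N) ℂ) : Matrix (Fin N) (Fin N) ℂ) * (M s * (I • Matrix.single k k (1 : ℂ)) * (I • Matrix.single k k (1 : ℂ))) * (((h⁻¹ : archLocal L N (Matrix.diagonal a) w) : GL (Fin N) ℂ) : Matrix (Fin N) (Fin N) ℂ))) ∂μ) :
    Integrable (fun h : archLocal L N (Matrix.diagonal a) w => fderiv ℝ f (((h : GL (Fin N) ℂ) : Matrix (Fin N) (Fin N) ℂ) * M 0 * (((h⁻¹ : archLocal L N (Matrix.diagonal a) w) : GL (Fin N) ℂ) : Matrix (Fin N) (Fin N) ℂ)) (((h : GL (Fin N) ℂ) : Matrix (Fin N) (Fin N) ℂ) * (M 0 * (I • Matrix.single k k (1 : ℂ))) * (((h⁻¹ : archLocal L N (Matrix.diagonal a) w) : GL (Fin N) ℂ) : Matrix (Fin N) (Fin N) ℂ))) μ ∧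
      Integrable (fun h : archLocal L N (Matrix.diagonal a) w => fderiv ℝ (fderiv ℝ f) (((h : GL (Fin N) ℂ) : Matrix (Fin N) (Fin N) ℂ) * M 0 * (((h⁻¹ : archLocal L N (Matrix.diagonal a) w) : GL (Fin N) ℂ) : Matrix (Fin N) (Fin N) ℂ)) (((h : GL (Fin N) ℂ) : Matrix (Fin N) (Fin N) ℂ) * (M 0 * (I • Matrix.single k k (1 : ℂ))) * (((h⁻¹ : archLocal L N (Matrix.diagonal a) w) : GL (Fin N) ℂ) : Matrix (Fin N) (Fin N) ℂ)) (((h : GL (Fin N) ℂ) : Matrix (Fin N) (Fin N) ℂ) * (M 0 * (I • Matrix.single k k (1 : ℂ))) * (((h⁻¹ : archLocal L N (Matrix.diagonal a) w) : GL (Fin N) ℂ) : Matrix (Fin N) (Fin N) ℂ)) +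
        fderiv ℝ f (((h : GL (Fin N) ℂ) : Matrix (Fin N) (Fin N) ℂ) * M 0 * (((h⁻¹ : archLocal L N (Matrix.diagonal a) w) : GL (Fin N) ℂ) : Matrix (Fin N) (Fin N) ℂ)) (((h : GL (Fin N) ℂ) : Matrix (Fin N) (Fin N) ℂ) * (M 0 * (I • Matrix.single k k (1 : ℂ)) * (I • Matrix.single k k (1 : ℂ))) * (((h⁻¹ : archLocal L N (Matrix.diagonal a) w) : GL (Fin N) ℂ) : Matrix (Fin N) (Fin N) ℂ))) μ ∧
      HasDerivAt O (O' 0) 0 ∧ HasDerivAt O' (O'' 0) 0 := by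
  -- the angle curve and its jets (§1)
  have hMfun : M = fun s : ℝ => Matrix.diagonal (fun i => ((Function.update z k (z k * Circle.exp s) i : Circle) : ℂ)) := funext hM
  have hMd : ∀ s : ℝ, HasDerivAt M (M s * (I • Matrix.single k k (1 : ℂ))) s := fun s => by rw [hMfun]; exact hasDerivAt_angleCurve z k s
  have hMc : Continuous M := continuous_iff_continuousAt.2 fun s => (hMd s).continuousAt
  have hM₁d : ∀ s : ℝ, HasDerivAt (fun s => M s * (I • Matrix.single k k (1 : ℂ))) (M s * (I • Matrix.single k k (1 : ℂ)) * (I • Matrix.single k k (1 : ℂ))) s := fun s => (hMd s).mul_const _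
  have hM₁c : Continuous fun s => M s * (I • Matrix.single k k (1 : ℂ)) := hMc.mul continuous_const
  have hM₂c : Continuous fun s => M s * (I • Matrix.single k k (1 : ℂ)) * (I • Matrix.single k k (1 : ℂ)) := hM₁c.mul continuous_const
  -- a closed ball of REGULAR parameters around `0`
  have hvc : Continuous fun s : ℝ => Function.update z k (z k * Circle.exp s) := continuous_const.update k (continuous_const.mul Circle.exp.continuous)
  have hv0 : Function.update z k (z k * Circle.exp 0) = z := by rw [Circle.exp_zero, mul_one, Function.update_eq_self]
  obtain ⟨δ, hδ, hδreg⟩ : ∃ δ > 0, ∀ s ∈ Metric.closedBall (0 : ℝ) δ, Function.Injective (Function.update z k (z k * Circle.exp s)) := by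
    have hmem : {v : Fin N → Circle | Function.Injective v} ∈ 𝓝 (Function.update z k (z k * Circle.exp 0)) := by
      rw [hv0]; exact isOpen_setOf_injective.mem_nhds hz
    obtain ⟨ε, hε, hball⟩ := Metric.eventually_nhds_iff_ball.1 (hvc.continuousAt.eventually_mem hmem)
    exact ⟨ε / 2, half_pos hε, fun s hs => hball s (Metric.closedBall_subset_ball (half_lt_self hε) hs)⟩
  -- the compact carrier over the closed ball (★ joint properness; `K_T` = the curve's image)
  have hKT : IsCompact ((fun s : ℝ => Function.update z k (z k * Circle.exp s)) '' Metric.closedBall (0 : ℝ) δ) := (isCompact_closedBall (0 : ℝ) δ).image hvc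
  have hKTreg : (fun s : ℝ => Function.update z k (z k * Circle.exp s)) '' Metric.closedBall (0 : ℝ) δ ⊆ {v | Function.Injective v} := by
    rintro _ ⟨s, hs, rfl⟩; exact hδreg s hs
  have hK := isCompact_setOf_exists_conj_circleDiagonal_mem L N a w ha hKT hKTreg (isCompact_setOf_coe_archLocal_mem L N a w ha hfc.isCompact)
  have hsupp : ∀ s ∈ Metric.ball (0 : ℝ) δ, ∀ h : archLocal L N (Matrix.diagonal a) w, h ∉ {g : archLocal L N (Matrix.diagonal a) w |
      ∃ v ∈ (fun s : ℝ => Function.update z k (z k * Circle.exp s)) '' Metric.closedBall (0 : ℝ) δ,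
        g * ⟨circleDiagonal N v, circleDiagonal_mem_archLocal_diagonal L N a w v⟩ * g⁻¹ ∈ {g : archLocal L N (Matrix.diagonal a) w | ((g : GL (Fin N) ℂ) : Matrix (Fin N) (Fin N) ℂ) ∈ tsupport f}} →
      ((h : GL (Fin N) ℂ) : Matrix (Fin N) (Fin N) ℂ) * M s * (((h⁻¹ : archLocal L N (Matrix.diagonal a) w) : GL (Fin N) ℂ) : Matrix (Fin N) (Fin N) ℂ) ∉ tsupport f := by
    intro s hs h hh hmem
    apply hh
    refine ⟨Function.update z k (z k * Circle.exp s), ⟨s, Metric.ball_subset_closedBall hs, rfl⟩, ?_⟩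
    simp only [Set.mem_setOf_eq, coe_conj_archLocal, coe_circleDiagonal]
    rw [← hM]
    exact hmem
  -- ★ Z2 (a), (b) along the angle curve
  have hZa := hasDerivAt_integral_comp_conj_curve (archLocal L N (Matrix.diagonal a) w) μ f (hf.of_le (by norm_num)) hMd hM₁c hδ hK hsupp
  have hZb := hasDerivAt_integral_fderiv_comp_conj_curve (archLocal L N (Matrix.diagonal a) w) μ f hf hMd hM₁d hM₂c hδ hK hsupp
  have hOfun : O = fun s : ℝ => ∫ h : archLocal L N (Matrix.diagonal a) w, f (((h : GL (Fin N) ℂ) : Matrix (Fin N) (Fin N) ℂ) * M s * (((h⁻¹ : archLocal L N (Matrix.diagonal a) w) : GL (Fin N) ℂ) : Matrix (Fin N) (Fin N) ℂ)) ∂μ := funext hO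
  have hO'fun : O' = fun s : ℝ => ∫ h : archLocal L N (Matrix.diagonal a) w, fderiv ℝ f (((h : GL (Fin N) ℂ) : Matrix (Fin N) (Fin N) ℂ) * M s * (((h⁻¹ : archLocal L N (Matrix.diagonal a) w) : GL (Fin N) ℂ) : Matrix (Fin N) (Fin N) ℂ)) (((h : GL (Fin N) ℂ) : Matrix (Fin N) (Fin N) ℂ) * (M s * (I • Matrix.single k k (1 : ℂ))) * (((h⁻¹ : archLocal L N (Matrix.diagonal a) w) : GL (Fin N) ℂ) : Matrix (Fin N) (Fin N) ℂ)) ∂μ := funext hO'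
  refine ⟨hZa.1, hZb.1, ?_, ?_⟩
  · rw [hOfun, hO']; exact hZa.2
  · rw [hO'fun, hO'']; exact hZb.2

end Orbital

end Literature.NumberTheory.Automorphic.RootVectors
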